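/-
Copyright (c) 2026 the pub-hodgecm-mathlib formalisation cell (harness21).  Prover seat hodgecm-mathlib-LH4-p12 (g7), req620 Track A «(D-RAM) FOUR-FRAME» squad
(heir LEAD F0P3a-plan (g20); dealer LH4-plan (g12)); helper lane `--supports stmt-HodgeConjecture-24833`.  2026-09-04.
-/
import Literature.NumberTheory.Automorphic.UnitaryThreeFourFrameModuleCriterion      -- ★ P-3 `frameProj_mul_frameProj_of_pairing_eq_zero`, P-4 `frameProj_mul_self`
import Literature.NumberTheory.Automorphic.UnitaryThreeFourFrameEigenframe           -- ★ `frameProj_mulVec_frame_self`, `frameProj_mulVec_frame_of_pairing_eq_zero`, `isUnit_det_frameMatrix`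
import Literature.NumberTheory.Automorphic.SelfDualLatticeFixOrderOnly               -- ★ `map_sub_one_le_scaleLattice_iff_map_shift_le` (the level ↔ shift dictionary)
import Summits.HodgeConjecture.HodgeConjecture.Theorems.F0P3cDyRamFourFrameCensusDefs  -- ★ DEFS: `LatticeInLevel`, `LatticeNearTransvShell`, `regFixCount`, `transv{Plus,Minus}FixCount` (brings №3 `InLevel`)
import HarnessLib

/-!
# Crux `H413`, line LH4 «(D-RAM) FOUR-FRAME» road — THE FRAME-DIAGONAL LEVEL ALGEBRA of the literal `z·Γ_b`:
# `(z·Γ_b − 1)^n = (zα−1)^n·π₀ + (zβ−1)^n·π₁ + (z−1)^n·π₂`, the square-level token as an in-level token, and the profile-count splits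

Cell `hodgecm-mathlib` (D-0151), FLOOR 0, crux item H413 = `stmt-HodgeConjecture-24833`, route of record `HCCMUnconditional`; squad F0∕P3c∕LH4 (req618∕req620).
THEOREMS ONLY (no `def`, no instance, no notation, no `sorry`, default heartbeats); lane `--supports stmt-HodgeConjecture-24833 --as helper` (count-neutral).
A STAGE-1b PRE-BRICK for the three open tier-0 rows `stub_rows_transvPlus ∕ _transvMinus ∕ _regular : PieceRowsWild gselStar j` (`Cruxes/H413/Lines/F0_P3c_DyRamFourFrame.lean`
ED. 3 @85∕89∕93): the profile pieces `f_{T±}`, `f_reg` (★ DEFS №3) read the SQUARE `X·X` of `X = ι_w u − 1`, and their census counts (★ `transvPlusFixCount`, `transvMinusFixCount`,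
`regFixCount` of the census DEFS) read `LatticeInLevel ϖ m ((T − 1)·(T − 1)) M` at a fixed type-0 vertex `M`.  At the literals of the dictionaries — `T = z·Γ_b`,
`Γ_b = frameElt σ f b α β = 1 + (α−1)π₀ + (β−1)π₁` in a four-frame family (`π_i = frameProj σ (f b i)`, ★ H3∕H7∕H8) — every polynomial in `T` is FRAME-DIAGONAL:

* §1 (pure algebra over a field): the projections of a four-frame family are ORTHOGONAL IDEMPOTENTS summing to `1` (`frameProj_mul_frameProj`, `frameProj_sum_eq_one` — ★ P-3∕P-4 +
  the invertible frame matrix ★ `isUnit_det_frameMatrix`); the product and power rules for `a₀π₀ + a₁π₁ + a₂π₂` (`frameDiag_mul_frameDiag`, `frameDiag_pow_succ`); the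
  eigenframe forms `z·Γ_b = (zα)π₀ + (zβ)π₁ + z·π₂`, `z·Γ_b − 1 = (zα−1)π₀ + (zβ−1)π₁ + (z−1)π₂`, `(z·Γ_b − 1)^{n+1} = (zα−1)^{n+1}π₀ + (zβ−1)^{n+1}π₁ + (z−1)^{n+1}π₂`, in
  particular `(z·Γ_b − 1)·(z·Γ_b − 1)`; at `z = 1` the square stays IN THE SAME FRAME FAMILY: `(Γ_b − 1)·(Γ_b − 1) = frameElt σ f b (1 + (α−1)²) (1 + (β−1)²) − 1`
  (axis parameters squared, root depths `n₁, n₂` doubled); and the multiplicativity `Γ_b(α,β)·Γ_b(α′,β′) = Γ_b(αα′, ββ′)`.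
* §2 (over a valued field): the SQUARE-LEVEL token `LatticeInLevel ϖ m ((z·Γ_b − 1)·(z·Γ_b − 1)) M` is the IN-LEVEL token of the frame-diagonal matrix
  `(zα−1)²π₀ + (zβ−1)²π₁ + (z−1)²π₂` (same for №3 `InLevel`), the in-level token of a two-axis frame-diagonal matrix is a DEFECT-SET membership
  (`LatticeInLevel ϖ m (a₀π₀ + a₁π₁) Λ ↔ (ϖ^{−m}a₀, ϖ^{−m}a₁) ∈ M_Λ`, ★ H12 — so the `z = 1` square-level token is A-0's module-criterion currency at the rescaled pair
  `(ϖ^{−m}(α−1)², ϖ^{−m}(β−1)²)`), and the profile counts SPLIT the anchor count: `regFixCount + #{square-level fixed} = fixedVertexCount 0` and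
  `transvPlusFixCount + transvMinusFixCount = #{shell fixed}` on a finite fixed set.

HONEST LABEL.  Count-neutral helper: pays no stub; the three tier-0 rows stay OPEN; `HC_CM` is proved only modulo the 7 printed citations (2 remaining named inputs: hLiu418 =
`stmt-HodgeConjecture-24832`, h413 = `stmt-HodgeConjecture-24833`) until rung 0 closes.

## References
* [Kottwitz1986BaseChangeUnits] R. E. Kottwitz, *Base change for unit elements of Hecke algebras*, Compositio Math. 60 (1986), §1 pp. 240–241 (orbital integrals of units as fixed-lattice counts of a torus element, frame by frame).
* [Rogawski1990] J. D. Rogawski, *Automorphic Representations of Unitary Groups in Three Variables*, Ann. of Math. Stud. 123 (1990), §3.6 pp. 28–29 (elliptic tori), §4.9 Prop. 4.9.1 p. 55.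
* [Jacobowitz1962] R. Jacobowitz, *Hermitian forms over local fields*, Amer. J. Math. 84 (1962), §4 (orthogonal frames).
-/

set_option autoImplicit false

noncomputable section

namespace Summit.HodgeConjecture.HodgeConjecture.Cruxes.H413.F0P3cDyRamFrameEltLevelAlgebra

open Literature.NumberTheory.Automorphic Literature.NumberTheory.Automorphic.UnitaryLatticeTree Literature.NumberTheory.Automorphic.HermitianLattice
open Literature.NumberTheory.Automorphic.UnitaryThreeFourFrame
open Summit.HodgeConjecture.HodgeConjecture.Cruxes.H413.F0P3cDyRamFourFramePieces
open Summit.HodgeConjecture.HodgeConjecture.Cruxes.H413.F0P3cDyRamFourFrameCensusDefs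
open scoped Matrix MatrixGroups Valued WithZero

/-! ## §1  The frame-diagonal calculus (any field) -/

section Algebra

variable {K : Type} [Field K] {σ : K →+* K} {f : Fin 4 → Fin 3 → (Fin 3 → K)}

/-- The three frame projections of a four-frame family are ORTHOGONAL IDEMPOTENTS: `π_i·π_j = δ_ij·π_i` (★ P-3, P-4). [cite: Jacobowitz1962, §4] [cite: Kottwitz1986BaseChangeUnits, §1 pp. 240–241] -/
theorem frameProj_mul_frameProj (hf : IsFourFrameFamily σ f) (b : Fin 4) (i j : Fin 3) :
    frameProj σ (f b i) * frameProj σ (f b j) = if i = j then frameProj σ (f b i) else 0 := by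
  obtain ⟨horth, hnz, -, -, -⟩ := hf b
  split_ifs with h
  · subst h
    exact frameProj_mul_self σ (hnz i)
  · exact frameProj_mul_frameProj_of_pairing_eq_zero σ (horth i j h)

/-- COMPLETENESS: `π₀ + π₁ + π₂ = 1` for a four-frame family (both sides agree on the frame vectors `f_b,j`, which are the columns of the invertible frame matrix
★ `isUnit_det_frameMatrix`). [cite: Jacobowitz1962, §4] [cite: Kottwitz1986BaseChangeUnits, §1 pp. 240–241] -/
theorem frameProj_sum_eq_one (hf : IsFourFrameFamily σ f) (b : Fin 4) :
    frameProj σ (f b 0) + frameProj σ (f b 1) + frameProj σ (f b 2) = 1 := by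
  obtain ⟨horth, hnz, -, -, -⟩ := hf b
  have hcol : ∀ j : Fin 3, (frameProj σ (f b 0) + frameProj σ (f b 1) + frameProj σ (f b 2)) *ᵥ f b j = f b j := by
    intro j
    fin_cases j
    · show (frameProj σ (f b 0) + frameProj σ (f b 1) + frameProj σ (f b 2)) *ᵥ f b 0 = f b 0
      rw [Matrix.add_mulVec, Matrix.add_mulVec, frameProj_mulVec_frame_self σ (hnz 0),
        frameProj_mulVec_frame_of_pairing_eq_zero σ (horth 1 0 (by decide)), frameProj_mulVec_frame_of_pairing_eq_zero σ (horth 2 0 (by decide)),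
        add_zero, add_zero]
    · show (frameProj σ (f b 0) + frameProj σ (f b 1) + frameProj σ (f b 2)) *ᵥ f b 1 = f b 1
      rw [Matrix.add_mulVec, Matrix.add_mulVec, frameProj_mulVec_frame_of_pairing_eq_zero σ (horth 0 1 (by decide)),
        frameProj_mulVec_frame_self σ (hnz 1), frameProj_mulVec_frame_of_pairing_eq_zero σ (horth 2 1 (by decide)), zero_add, add_zero]
    · show (frameProj σ (f b 0) + frameProj σ (f b 1) + frameProj σ (f b 2)) *ᵥ f b 2 = f b 2
      rw [Matrix.add_mulVec, Matrix.add_mulVec, frameProj_mulVec_frame_of_pairing_eq_zero σ (horth 0 2 (by decide)),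
        frameProj_mulVec_frame_of_pairing_eq_zero σ (horth 1 2 (by decide)), frameProj_mulVec_frame_self σ (hnz 2), zero_add, zero_add]
  have hQ : (frameProj σ (f b 0) + frameProj σ (f b 1) + frameProj σ (f b 2)) * (Matrix.of (f b))ᵀ = 1 * (Matrix.of (f b))ᵀ := by
    ext m i
    have h := congrFun (hcol i) m
    rw [Matrix.mulVec, dotProduct] at h
    rw [Matrix.one_mul, Matrix.transpose_apply, Matrix.of_apply, ← h, Matrix.mul_apply]
    simp only [Matrix.transpose_apply, Matrix.of_apply]
  exact ((Matrix.isUnit_iff_isUnit_det _).2 (isUnit_det_frameMatrix hf b)).mul_left_inj.1 hQ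

/-- PRODUCT RULE for frame-diagonal matrices: `(a₀π₀ + a₁π₁ + a₂π₂)·(b₀π₀ + b₁π₁ + b₂π₂) = (a₀b₀)π₀ + (a₁b₁)π₁ + (a₂b₂)π₂`. [cite: Kottwitz1986BaseChangeUnits, §1 pp. 240–241] -/
theorem frameDiag_mul_frameDiag (hf : IsFourFrameFamily σ f) (b : Fin 4) (a₀ a₁ a₂ b₀ b₁ b₂ : K) :
    (a₀ • frameProj σ (f b 0) + a₁ • frameProj σ (f b 1) + a₂ • frameProj σ (f b 2)) *
        (b₀ • frameProj σ (f b 0) + b₁ • frameProj σ (f b 1) + b₂ • frameProj σ (f b 2)) =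
      (a₀ * b₀) • frameProj σ (f b 0) + (a₁ * b₁) • frameProj σ (f b 1) + (a₂ * b₂) • frameProj σ (f b 2) := by
  obtain ⟨horth, hnz, -, -, -⟩ := hf b
  have h00 := frameProj_mul_self σ (hnz 0)
  have h11 := frameProj_mul_self σ (hnz 1)
  have h22 := frameProj_mul_self σ (hnz 2)
  have h01 := frameProj_mul_frameProj_of_pairing_eq_zero σ (horth 0 1 (by decide))
  have h02 := frameProj_mul_frameProj_of_pairing_eq_zero σ (horth 0 2 (by decide))
  have h10 := frameProj_mul_frameProj_of_pairing_eq_zero σ (horth 1 0 (by decide))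
  have h12 := frameProj_mul_frameProj_of_pairing_eq_zero σ (horth 1 2 (by decide))
  have h20 := frameProj_mul_frameProj_of_pairing_eq_zero σ (horth 2 0 (by decide))
  have h21 := frameProj_mul_frameProj_of_pairing_eq_zero σ (horth 2 1 (by decide))
  simp only [add_mul, mul_add, Matrix.smul_mul, Matrix.mul_smul, smul_smul, h00, h11, h22, h01, h02, h10, h12, h20, h21, smul_zero, add_zero, zero_add]
  rw [mul_comm b₀ a₀, mul_comm b₁ a₁, mul_comm b₂ a₂]

/-- POWER RULE: `(a₀π₀ + a₁π₁ + a₂π₂)^{n+1} = a₀^{n+1}π₀ + a₁^{n+1}π₁ + a₂^{n+1}π₂`. [cite: Kottwitz1986BaseChangeUnits, §1 pp. 240–241] -/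
theorem frameDiag_pow_succ (hf : IsFourFrameFamily σ f) (b : Fin 4) (a₀ a₁ a₂ : K) (n : ℕ) :
    (a₀ • frameProj σ (f b 0) + a₁ • frameProj σ (f b 1) + a₂ • frameProj σ (f b 2)) ^ (n + 1) =
      a₀ ^ (n + 1) • frameProj σ (f b 0) + a₁ ^ (n + 1) • frameProj σ (f b 1) + a₂ ^ (n + 1) • frameProj σ (f b 2) := by
  induction n with
  | zero => simp only [zero_add, pow_one]
  | succ n ih => rw [pow_succ, ih, frameDiag_mul_frameDiag hf b, ← pow_succ, ← pow_succ, ← pow_succ]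

/-- `Γ_b − 1 = (α−1)π₀ + (β−1)π₁` (H8 unfolded; no frame hypothesis). [cite: Kottwitz1986BaseChangeUnits, §1 pp. 240–241] -/
theorem frameElt_sub_one (σ : K →+* K) (f : Fin 4 → Fin 3 → (Fin 3 → K)) (b : Fin 4) (α β : K) :
    frameElt σ f b α β - 1 = (α - 1) • frameProj σ (f b 0) + (β - 1) • frameProj σ (f b 1) := by
  rw [frameElt, add_assoc, add_sub_cancel_left]

/-- EIGENFRAME FORM of the frame element: `Γ_b = α·π₀ + β·π₁ + 1·π₂` (completeness). [cite: Rogawski1990, §3.6 pp. 28–29] [cite: Kottwitz1986BaseChangeUnits, §1 pp. 240–241] -/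
theorem frameElt_eq_frameDiag (hf : IsFourFrameFamily σ f) (b : Fin 4) (α β : K) :
    frameElt σ f b α β = α • frameProj σ (f b 0) + β • frameProj σ (f b 1) + (1 : K) • frameProj σ (f b 2) := by
  rw [frameElt, ← frameProj_sum_eq_one hf b]
  module

/-- EIGENFRAME FORM of the dictionary literal: `z·Γ_b = (zα)π₀ + (zβ)π₁ + z·π₂`. [cite: Rogawski1990, §3.6 pp. 28–29; §4.9 p. 54] -/
theorem smul_frameElt_eq_frameDiag (hf : IsFourFrameFamily σ f) (b : Fin 4) (α β z : K) :
    z • frameElt σ f b α β = (z * α) • frameProj σ (f b 0) + (z * β) • frameProj σ (f b 1) + z • frameProj σ (f b 2) := by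
  rw [frameElt_eq_frameDiag hf b]
  module

/-- `z·Γ_b − 1 = (zα−1)π₀ + (zβ−1)π₁ + (z−1)π₂` — the operator `T − 1` of the literal `T = z·Γ_b` in its eigenframe. [cite: Rogawski1990, §4.9 p. 54] [cite: Kottwitz1986BaseChangeUnits, §1 pp. 240–241] -/
theorem smul_frameElt_sub_one_eq_frameDiag (hf : IsFourFrameFamily σ f) (b : Fin 4) (α β z : K) :
    z • frameElt σ f b α β - 1 = (z * α - 1) • frameProj σ (f b 0) + (z * β - 1) • frameProj σ (f b 1) + (z - 1) • frameProj σ (f b 2) := by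
  rw [frameElt_eq_frameDiag hf b, ← frameProj_sum_eq_one hf b]
  module

/-- POWERS of `T − 1`, `T = z·Γ_b`: `(z·Γ_b − 1)^{n+1} = (zα−1)^{n+1}π₀ + (zβ−1)^{n+1}π₁ + (z−1)^{n+1}π₂`. [cite: Kottwitz1986BaseChangeUnits, §1 pp. 240–241] -/
theorem smul_frameElt_sub_one_pow_succ (hf : IsFourFrameFamily σ f) (b : Fin 4) (α β z : K) (n : ℕ) :
    (z • frameElt σ f b α β - 1) ^ (n + 1) =
      (z * α - 1) ^ (n + 1) • frameProj σ (f b 0) + (z * β - 1) ^ (n + 1) • frameProj σ (f b 1) + (z - 1) ^ (n + 1) • frameProj σ (f b 2) := by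
  rw [smul_frameElt_sub_one_eq_frameDiag hf b, frameDiag_pow_succ hf b]

/-- THE SQUARE of `T − 1`, `T = z·Γ_b` (the `X·X` the profile pieces read): `(z·Γ_b − 1)·(z·Γ_b − 1) = (zα−1)²π₀ + (zβ−1)²π₁ + (z−1)²π₂`.
[cite: Rogawski1990, §4.9 Prop. 4.9.1 p. 55] [cite: Kottwitz1986BaseChangeUnits, §1 pp. 240–241] -/
theorem smul_frameElt_sub_one_mul_self (hf : IsFourFrameFamily σ f) (b : Fin 4) (α β z : K) :
    (z • frameElt σ f b α β - 1) * (z • frameElt σ f b α β - 1) =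
      (z * α - 1) ^ 2 • frameProj σ (f b 0) + (z * β - 1) ^ 2 • frameProj σ (f b 1) + (z - 1) ^ 2 • frameProj σ (f b 2) := by
  rw [← pow_two, smul_frameElt_sub_one_pow_succ hf b α β z 1]

/-- AT `z = 1` THE SQUARE STAYS IN THE FRAME FAMILY: `(Γ_b − 1)·(Γ_b − 1) = frameElt σ f b (1 + (α−1)²) (1 + (β−1)²) − 1` — the square-level condition of `Γ_b(α, β)` is the
in-level condition of the SAME frame at the squared axis parameters (root depths `n₂ = v(α−1)`, `n₁ = v(β−1)` doubled). [cite: Kottwitz1986BaseChangeUnits, §1 pp. 240–241] [cite: Rogawski1990, §4.9 Prop. 4.9.1 p. 55] -/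
theorem frameElt_sub_one_mul_self (hf : IsFourFrameFamily σ f) (b : Fin 4) (α β : K) :
    (frameElt σ f b α β - 1) * (frameElt σ f b α β - 1) = frameElt σ f b (1 + (α - 1) ^ 2) (1 + (β - 1) ^ 2) - 1 := by
  have h := smul_frameElt_sub_one_mul_self hf b α β 1
  rw [one_smul, one_mul, one_mul, sub_self, zero_pow two_ne_zero, zero_smul, add_zero] at h
  rw [h, frameElt_sub_one, add_sub_cancel_left, add_sub_cancel_left]

/-- THE GENERAL PRODUCT at `z = 1`: `(Γ_b(α,β) − 1)·(Γ_b(α′,β′) − 1) = Γ_b(1 + (α−1)(α′−1), 1 + (β−1)(β′−1)) − 1`. [cite: Kottwitz1986BaseChangeUnits, §1 pp. 240–241] -/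
theorem frameElt_sub_one_mul_frameElt_sub_one (hf : IsFourFrameFamily σ f) (b : Fin 4) (α β α' β' : K) :
    (frameElt σ f b α β - 1) * (frameElt σ f b α' β' - 1) = frameElt σ f b (1 + (α - 1) * (α' - 1)) (1 + (β - 1) * (β' - 1)) - 1 := by
  have h := frameDiag_mul_frameDiag hf b (α - 1) (β - 1) 0 (α' - 1) (β' - 1) 0
  simp only [zero_smul, add_zero, mul_zero] at h
  rw [frameElt_sub_one, frameElt_sub_one, frameElt_sub_one, h, add_sub_cancel_left, add_sub_cancel_left]

/-- MULTIPLICATIVITY of the frame element in its parameters: `Γ_b(α,β)·Γ_b(α′,β′) = Γ_b(αα′, ββ′)` (the torus `diag(α, β, 1)` of frame `b`; ★ P-5 is the case `α′ = α⁻¹`).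
[cite: Rogawski1990, §3.6 pp. 28–29] [cite: Kottwitz1986BaseChangeUnits, §1 pp. 240–241] -/
theorem frameElt_mul_frameElt (hf : IsFourFrameFamily σ f) (b : Fin 4) (α β α' β' : K) :
    frameElt σ f b α β * frameElt σ f b α' β' = frameElt σ f b (α * α') (β * β') := by
  rw [frameElt_eq_frameDiag hf b, frameElt_eq_frameDiag hf b, frameElt_eq_frameDiag hf b, frameDiag_mul_frameDiag hf b, mul_one]

end Algebra

/-! ## §2  Level readings and the profile-count splits (valued field) -/

section Levels

variable {K : Type} [Field K] [Valued K ℤᵐ⁰] {σ : K →+* K} {f : Fin 4 → Fin 3 → (Fin 3 → K)}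

/-- THE SQUARE-LEVEL TOKEN IS AN IN-LEVEL TOKEN (lattice side, ★ census DEFS `LatticeInLevel`): at every lattice `M`,
`(z·Γ_b − 1)²·M ⊆ ϖ^m·M ⟺ ((zα−1)²π₀ + (zβ−1)²π₁ + (z−1)²π₂)·M ⊆ ϖ^m·M`. [cite: Kottwitz1986BaseChangeUnits, §1 pp. 240–241] [cite: Rogawski1990, §4.9 Prop. 4.9.1 p. 55] -/
theorem latticeInLevel_sq_smul_frameElt_iff (hf : IsFourFrameFamily σ f) (b : Fin 4) (α β z ϖ : K) (m : ℕ) (M : Submodule 𝒪[K] (Fin 3 → K)) :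
    LatticeInLevel ϖ m ((z • frameElt σ f b α β - 1) * (z • frameElt σ f b α β - 1)) M ↔
      LatticeInLevel ϖ m ((z * α - 1) ^ 2 • frameProj σ (f b 0) + (z * β - 1) ^ 2 • frameProj σ (f b 1) + (z - 1) ^ 2 • frameProj σ (f b 2)) M := by
  rw [smul_frameElt_sub_one_mul_self hf b]

/-- The same on the group side (★ DEFS №3 `InLevel`, entries of `ϖ^{−m}·X·X`). [cite: Rogawski1990, §4.9 Prop. 4.9.1 p. 55] -/
theorem inLevel_sq_smul_frameElt_iff (hf : IsFourFrameFamily σ f) (b : Fin 4) (α β z ϖ : K) (m : ℕ) :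
    InLevel ϖ m ((z • frameElt σ f b α β - 1) * (z • frameElt σ f b α β - 1)) ↔
      InLevel ϖ m ((z * α - 1) ^ 2 • frameProj σ (f b 0) + (z * β - 1) ^ 2 • frameProj σ (f b 1) + (z - 1) ^ 2 • frameProj σ (f b 2)) := by
  rw [smul_frameElt_sub_one_mul_self hf b]

/-- At `z = 1`: `(Γ_b − 1)²·M ⊆ ϖ^m·M ⟺ (Γ_b(1 + (α−1)², 1 + (β−1)²) − 1)·M ⊆ ϖ^m·M` — the square-level token of `Γ_b` is the in-level token of the squared-parameter frame
element. [cite: Kottwitz1986BaseChangeUnits, §1 pp. 240–241] -/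
theorem latticeInLevel_sq_frameElt_iff (hf : IsFourFrameFamily σ f) (b : Fin 4) (α β ϖ : K) (m : ℕ) (M : Submodule 𝒪[K] (Fin 3 → K)) :
    LatticeInLevel ϖ m ((frameElt σ f b α β - 1) * (frameElt σ f b α β - 1)) M ↔
      LatticeInLevel ϖ m (frameElt σ f b (1 + (α - 1) ^ 2) (1 + (β - 1) ^ 2) - 1) M := by
  rw [frameElt_sub_one_mul_self hf b]

/-- IN-LEVEL ⟺ DEFECT-SET MEMBERSHIP (★ H12): for a two-axis frame-diagonal matrix, `(a₀π₀ + a₁π₁)·Λ ⊆ ϖ^m·Λ ⟺ (ϖ^{−m}a₀, ϖ^{−m}a₁) ∈ M_Λ` (`ϖ ≠ 0`; the level ↔ shift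
dictionary ★ `map_sub_one_le_scaleLattice_iff_map_shift_le`).  With §1 this puts the `z = 1` square-level token of `Γ_b` into A-0's module-criterion currency at the pair
`(ϖ^{−m}(α−1)², ϖ^{−m}(β−1)²)`. [cite: Kottwitz1986BaseChangeUnits, §1 pp. 240–241] [cite: Rogawski1990, §4.9 Prop. 4.9.1 p. 55] -/
theorem latticeInLevel_frameDiag_iff_mem_defectSet (σ : K →+* K) (f : Fin 4 → Fin 3 → (Fin 3 → K)) (b : Fin 4) {ϖ : K} (hϖ : ϖ ≠ 0) (m : ℕ) (a₀ a₁ : K)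
    (Λ : Submodule 𝒪[K] (Fin 3 → K)) :
    LatticeInLevel ϖ m (a₀ • frameProj σ (f b 0) + a₁ • frameProj σ (f b 1)) Λ ↔
      ((ϖ ^ m)⁻¹ * a₀, (ϖ ^ m)⁻¹ * a₁) ∈ defectSet (frameProj σ (f b 0)) (frameProj σ (f b 1)) Λ := by
  have h := map_sub_one_le_scaleLattice_iff_map_shift_le (pow_ne_zero m hϖ) (a₀ • frameProj σ (f b 0) + a₁ • frameProj σ (f b 1) + 1) Λ
  rw [add_sub_cancel_right, smul_add, smul_smul, smul_smul] at h
  exact h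

/-- The `z = 1` square-level token of `Γ_b` as a defect-set membership: `(Γ_b − 1)²·Λ ⊆ ϖ^m·Λ ⟺ (ϖ^{−m}(α−1)², ϖ^{−m}(β−1)²) ∈ M_Λ`.
[cite: Kottwitz1986BaseChangeUnits, §1 pp. 240–241] [cite: Rogawski1990, §4.9 Prop. 4.9.1 p. 55] -/
theorem latticeInLevel_sq_frameElt_iff_mem_defectSet (hf : IsFourFrameFamily σ f) (b : Fin 4) (α β : K) {ϖ : K} (hϖ : ϖ ≠ 0) (m : ℕ)
    (Λ : Submodule 𝒪[K] (Fin 3 → K)) :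
    LatticeInLevel ϖ m ((frameElt σ f b α β - 1) * (frameElt σ f b α β - 1)) Λ ↔
      ((ϖ ^ m)⁻¹ * (α - 1) ^ 2, (ϖ ^ m)⁻¹ * (β - 1) ^ 2) ∈ defectSet (frameProj σ (f b 0)) (frameProj σ (f b 1)) Λ := by
  rw [frameElt_sub_one_mul_self hf b, frameElt_sub_one, add_sub_cancel_left, add_sub_cancel_left]
  exact latticeInLevel_frameDiag_iff_mem_defectSet σ f b hϖ m _ _ Λ

/-- The in-level token of `Γ_b` itself as a defect-set membership: `(Γ_b − 1)·Λ ⊆ ϖ^m·Λ ⟺ (ϖ^{−m}(α−1), ϖ^{−m}(β−1)) ∈ M_Λ` (`m = 0` is A-0's right-hand side).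
[cite: Kottwitz1986BaseChangeUnits, §1 pp. 240–241] -/
theorem latticeInLevel_frameElt_iff_mem_defectSet (σ : K →+* K) (f : Fin 4 → Fin 3 → (Fin 3 → K)) (b : Fin 4) (α β : K) {ϖ : K} (hϖ : ϖ ≠ 0) (m : ℕ)
    (Λ : Submodule 𝒪[K] (Fin 3 → K)) :
    LatticeInLevel ϖ m (frameElt σ f b α β - 1) Λ ↔
      ((ϖ ^ m)⁻¹ * (α - 1), (ϖ ^ m)⁻¹ * (β - 1)) ∈ defectSet (frameProj σ (f b 0)) (frameProj σ (f b 1)) Λ := by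
  rw [frameElt_sub_one]
  exact latticeInLevel_frameDiag_iff_mem_defectSet σ f b hϖ m _ _ Λ

/-- THE REGULAR PROFILE COUNT SPLITS THE ANCHOR COUNT: on a finite fixed set, `#{square-level fixed type-0 vertices} + regFixCount σ ϖ m T = fixedVertexCount σ ϖ 0 T`
(the complement of the regular profile inside the fixed set is the square-level profile `(T−1)²·M ⊆ ϖ^m·M`; cf. `f_reg = 1_K − 𝟙{K, X² ∈ ϖ^{m}M₃(𝒪)}`).
[cite: Kottwitz1986BaseChangeUnits, §1 pp. 240–241] [cite: Rogawski1990, §4.9 Prop. 4.9.1 (b) p. 55] -/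
theorem ncard_sqLevel_add_regFixCount_eq_fixedVertexCount (σ : K →+* K) (ϖ : K) (m : ℕ) (T : GL (Fin 3) K)
    (hfin : {M : Submodule 𝒪[K] (Fin 3 → K) | IsVertexLattice σ ϖ ((StdForm.antidiagonal 3).over K) 0 M ∧ mapGL T M = M}.Finite) :
    {M : Submodule 𝒪[K] (Fin 3 → K) | IsVertexLattice σ ϖ ((StdForm.antidiagonal 3).over K) 0 M ∧ mapGL T M = M ∧
        LatticeInLevel ϖ m (((T : Matrix (Fin 3) (Fin 3) K) - 1) * ((T : Matrix (Fin 3) (Fin 3) K) - 1)) M}.ncard +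
      regFixCount σ ϖ m T = fixedVertexCount σ ϖ 0 T := by
  have h := Set.ncard_inter_add_ncard_sdiff_eq_ncard
    {M : Submodule 𝒪[K] (Fin 3 → K) | IsVertexLattice σ ϖ ((StdForm.antidiagonal 3).over K) 0 M ∧ mapGL T M = M}
    {M : Submodule 𝒪[K] (Fin 3 → K) | LatticeInLevel ϖ m (((T : Matrix (Fin 3) (Fin 3) K) - 1) * ((T : Matrix (Fin 3) (Fin 3) K) - 1)) M} hfin
  have h1 : {M : Submodule 𝒪[K] (Fin 3 → K) | IsVertexLattice σ ϖ ((StdForm.antidiagonal 3).over K) 0 M ∧ mapGL T M = M} ∩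
      {M : Submodule 𝒪[K] (Fin 3 → K) | LatticeInLevel ϖ m (((T : Matrix (Fin 3) (Fin 3) K) - 1) * ((T : Matrix (Fin 3) (Fin 3) K) - 1)) M} =
      {M : Submodule 𝒪[K] (Fin 3 → K) | IsVertexLattice σ ϖ ((StdForm.antidiagonal 3).over K) 0 M ∧ mapGL T M = M ∧
        LatticeInLevel ϖ m (((T : Matrix (Fin 3) (Fin 3) K) - 1) * ((T : Matrix (Fin 3) (Fin 3) K) - 1)) M} := by
    ext M
    simp only [Set.mem_inter_iff, Set.mem_setOf_eq, and_assoc]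
  have h2 : {M : Submodule 𝒪[K] (Fin 3 → K) | IsVertexLattice σ ϖ ((StdForm.antidiagonal 3).over K) 0 M ∧ mapGL T M = M} \
      {M : Submodule 𝒪[K] (Fin 3 → K) | LatticeInLevel ϖ m (((T : Matrix (Fin 3) (Fin 3) K) - 1) * ((T : Matrix (Fin 3) (Fin 3) K) - 1)) M} =
      {M : Submodule 𝒪[K] (Fin 3 → K) | IsVertexLattice σ ϖ ((StdForm.antidiagonal 3).over K) 0 M ∧ mapGL T M = M ∧
        ¬ LatticeInLevel ϖ m (((T : Matrix (Fin 3) (Fin 3) K) - 1) * ((T : Matrix (Fin 3) (Fin 3) K) - 1)) M} := by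
    ext M
    simp only [Set.mem_sdiff, Set.mem_setOf_eq, and_assoc]
  rw [h1, h2] at h
  exact h

/-- THE TWO TRANSVECTION PROFILE COUNTS SPLIT THE SHELL COUNT: on a finite fixed set,
`transvPlusFixCount σ ϖ d ℓ m T + transvMinusFixCount σ ϖ d ℓ m T = #{fixed type-0 vertices on the near-transvection shell (ℓ, m)}` (label `+` and its negation;
cf. `f_{T+} + f_{T−} = 𝟙{K ∩ shell}`). [cite: Kottwitz1986BaseChangeUnits, §1 pp. 240–241] [cite: Rogawski1990, §4.9 Prop. 4.9.1 (b) p. 55] -/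
theorem transvPlusFixCount_add_transvMinusFixCount (σ : K →+* K) (ϖ : K) (d ℓ m : ℕ) (T : GL (Fin 3) K)
    (hfin : {M : Submodule 𝒪[K] (Fin 3 → K) | IsVertexLattice σ ϖ ((StdForm.antidiagonal 3).over K) 0 M ∧ mapGL T M = M}.Finite) :
    transvPlusFixCount σ ϖ d ℓ m T + transvMinusFixCount σ ϖ d ℓ m T =
      {M : Submodule 𝒪[K] (Fin 3 → K) | IsVertexLattice σ ϖ ((StdForm.antidiagonal 3).over K) 0 M ∧ mapGL T M = M ∧
        LatticeNearTransvShell ϖ ℓ m ((T : Matrix (Fin 3) (Fin 3) K) - 1) M}.ncard := by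
  have hfin' : {M : Submodule 𝒪[K] (Fin 3 → K) | IsVertexLattice σ ϖ ((StdForm.antidiagonal 3).over K) 0 M ∧ mapGL T M = M ∧
      LatticeNearTransvShell ϖ ℓ m ((T : Matrix (Fin 3) (Fin 3) K) - 1) M}.Finite :=
    hfin.subset fun M hM => ⟨hM.1, hM.2.1⟩
  have h := Set.ncard_inter_add_ncard_sdiff_eq_ncard
    {M : Submodule 𝒪[K] (Fin 3 → K) | IsVertexLattice σ ϖ ((StdForm.antidiagonal 3).over K) 0 M ∧ mapGL T M = M ∧
      LatticeNearTransvShell ϖ ℓ m ((T : Matrix (Fin 3) (Fin 3) K) - 1) M}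
    {M : Submodule 𝒪[K] (Fin 3 → K) | LatticeLabelPlus σ ϖ d m M ((T : Matrix (Fin 3) (Fin 3) K) - 1)} hfin'
  have h1 : {M : Submodule 𝒪[K] (Fin 3 → K) | IsVertexLattice σ ϖ ((StdForm.antidiagonal 3).over K) 0 M ∧ mapGL T M = M ∧
        LatticeNearTransvShell ϖ ℓ m ((T : Matrix (Fin 3) (Fin 3) K) - 1) M} ∩
      {M : Submodule 𝒪[K] (Fin 3 → K) | LatticeLabelPlus σ ϖ d m M ((T : Matrix (Fin 3) (Fin 3) K) - 1)} =
      {M : Submodule 𝒪[K] (Fin 3 → K) | IsVertexLattice σ ϖ ((StdForm.antidiagonal 3).over K) 0 M ∧ mapGL T M = M ∧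
        LatticeNearTransvShell ϖ ℓ m ((T : Matrix (Fin 3) (Fin 3) K) - 1) M ∧ LatticeLabelPlus σ ϖ d m M ((T : Matrix (Fin 3) (Fin 3) K) - 1)} := by
    ext M
    simp only [Set.mem_inter_iff, Set.mem_setOf_eq, and_assoc]
  have h2 : {M : Submodule 𝒪[K] (Fin 3 → K) | IsVertexLattice σ ϖ ((StdForm.antidiagonal 3).over K) 0 M ∧ mapGL T M = M ∧
        LatticeNearTransvShell ϖ ℓ m ((T : Matrix (Fin 3) (Fin 3) K) - 1) M} \
      {M : Submodule 𝒪[K] (Fin 3 → K) | LatticeLabelPlus σ ϖ d m M ((T : Matrix (Fin 3) (Fin 3) K) - 1)} =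
      {M : Submodule 𝒪[K] (Fin 3 → K) | IsVertexLattice σ ϖ ((StdForm.antidiagonal 3).over K) 0 M ∧ mapGL T M = M ∧
        LatticeNearTransvShell ϖ ℓ m ((T : Matrix (Fin 3) (Fin 3) K) - 1) M ∧ ¬ LatticeLabelPlus σ ϖ d m M ((T : Matrix (Fin 3) (Fin 3) K) - 1)} := by
    ext M
    simp only [Set.mem_sdiff, Set.mem_setOf_eq, and_assoc]
  rw [h1, h2] at h
  rw [transvPlusFixCount, transvMinusFixCount]
  exact h

end Levels

end Summit.HodgeConjecture.HodgeConjecture.Cruxes.H413.F0P3cDyRamFrameEltLevelAlgebra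

end
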